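import Summits.ResolutionOfSingularities.ResolutionOfSingularities.Theorems.MarkedTransferCampaignW46MohWindowSurfaceHeavyInsep
import Literature.AlgebraicGeometry.Resolution.PointBlowupShade
import Literature.Barriers.ResolutionOfSingularities.ResidualOrderUnboundedNarrow
import Literature.Barriers.ResolutionOfSingularities.ResidualOrderUnboundedBounds
import HarnessLib

/-!
# [OURS · L1 W4.6 rung (iii-2), ENTRANCE DOOR, brick 1] Polynomial anchors of the shade model in a regular local ring:
# quasi-regular readings of order, singularity and the window

Cell `res-hironaka`, LADDER-RESOLUTION rung L (D-0089), slot W4.6 rung (iii) «purely inseparable surface Moh window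
`z^p + F(x, y)`, `p ≤ ord F < 2p` at every stage»; seat res-L1-s46-pv-6 (gen 4). Host route MarkedTransfer,
`--supports stmt-ResolutionOfSingularities-16155 --as helper`; kind proof (no definition).

WHY. This seat's MODEL-LEVEL termination theorem (`…MohWindowShadeTerminationStatement` v2 p510162, closer p510427,
normal form `…MohWindowShadeFormalBranch.exists_coordinate_or_digit_curve_of_walk` p512535) speaks about polynomial states
`x^p + F(y_j, y_i)`, `F ∈ K[y]`; the scheme-level rung `CampaignW46.MohWindowSurfaceInsepPermissiblyTerminates` (res-L1-type-o1,
`…MohWindowSurface.lean` §3) speaks about stalks `𝒪_{Z,ξ}` and `J_ξ`. The ENTRANCE DOOR between them (this seat's gen-4 object,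
STATUS 2026-08-27T08:49Z; the EXIT DOOR is res-D-pv-050 AS s46-pv-12's p514487) presents `J_ξ` by a POLYNOMIAL ANCHOR: a regular
system of parameters `(x, y, z)` of the regular three-dimensional `R = 𝒪_{Z,ξ}`, constants `κ : K → R` (a ring map from the
base FIELD), and a polynomial `G` over `K` with `J_ξ = (z^p + G(x, y, z))`, `G(x,y,z) = eval₂ κ ![x,y,z] G` — for the model,
`G` is the residual polynomial `F` in two letters read as `y_j ↦ x`, `y_i ↦ y`. This file is the RING-LEVEL dictionary
«intrinsic data of `(R, J_ξ)` ↔ `ord₀ G`», from the quasi-regularity of a regular system of parameters (tree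
`IsRsopPart.isQuasiRegular` through res-D-pv-008's `MohWindowSurfaceResidualOrder.coeff_mem_of_eval_mem_pow_succ`):

* `eval₂_mem_pow_of_forall_le_degree`, `eval₂_mem_pow_ordZero` — `G(v) ∈ I^n` when every monomial of `G` has degree `≥ n`
  and `v` takes values in `I`; in particular `G(v) ∈ I ^ ord₀ G`;
* `natCast_le_ordZero_of_eval₂_mem_pow` — **quasi-regularity read on `K`-polynomials**: `G(x,y,z) ∈ 𝔪^n ⟹ n ≤ ord₀ G`;
* `natCast_le_ordZero_of_span_le_pow` — **singularity reading**: `(z^p + G(x,y,z)) ⊆ 𝔪^p ⟹ p ≤ ord₀ G`, and the converse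
  `span_le_pow_of_natCast_le_ordZero`;
* `natCast_ordZero_le_residualOrder` — `ord₀ G ≤ residualOrder p R (z^p + G(x,y,z))` (o1's intrinsic residual order, §6);
* `ordZero_lt_two_mul_of_mohWindowSurfaceAt` — **window reading**: if `(z^p + G(x,y,z))` is a surface window germ of exponent
  `p` in o1's sense (`MohWindowSurfaceAt p R ·`, ANY presentation) then `ord₀ G < 2p` (res-D-pv-050's `residualOrder_coeff` via
  `MohWindowSurfaceAt.coeffAt`);
* `mohWindowSurfaceAt_of_anchor` — conversely an anchor whose polynomial lives in the two letters `x, y` (`G = rename ι F`,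
  `ι` into `{0, 1}`) with `p < ord₀ F < 2p` IS a surface window germ: the polynomial sub-regime of the entrance door sits
  inside o1's regime of record.

HONEST FRAMING. Nothing here is a statement of H. Hironaka's manuscript [Hironaka2017] (2017-03-23; Th. 16.6 p.84, Th. 16.13
p.87 — scope only, under adjudication) and nothing asserts that any statement of it holds; `MohWindowSurfaceAt`, `residualOrder`
are OURS campaign definitions (res-L1-type-o1). AI-written; AI review is weaker than expert review. No `sorry`; axioms standard.
References: H. Matsumura, *Commutative Ring Theory* (1986), Thm. 16.2 (i) (quasi-regularity), Thm. 14.2; H. Hauser, Bull. AMS 47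
(2010) §C (order at a point), §F (the residual polynomial). [Matsumura1987] [Hauser2010] [folklore]
-/

noncomputable section

set_option linter.dupNamespace false -- mandated namespace of this single-conjunct summit

open IsLocalRing MvPolynomial

namespace Summit.ResolutionOfSingularities.ResolutionOfSingularities.Theorems

namespace CampaignW46

namespace MohWindowShadeAnchor

open Literature.AlgebraicGeometry.Resolution
open Literature.AlgebraicGeometry.Resolution.Hauser2010
open Literature.Barriers.ResolutionOfSingularities.HauserPerlega (natCast_le_ordZero_iff ordZero_ne_top ordZero_rename)

universe u v

variable {R : Type u} [CommRing R]

/-! ## §1 Evaluating a polynomial of order `≥ n` inside an ideal -/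

/-- A polynomial all of whose monomials have degree `≥ n`, evaluated at elements of an ideal `I`, lies in `I^n`. [folklore] -/
theorem eval₂_mem_pow_of_forall_le_degree {S : Type v} [CommRing S] {τ : Type*} (f : S →+* R) (I : Ideal R)
    {v : τ → R} (hv : ∀ l, v l ∈ I) (G : MvPolynomial τ S) {n : ℕ} (hG : ∀ d ∈ G.support, n ≤ d.degree) :
    eval₂ f v G ∈ I ^ n := by
  classical
  rw [MvPolynomial.eval₂_eq]
  refine Ideal.sum_mem _ fun d hd => Ideal.mul_mem_left _ _ ?_
  have hprod : ∏ i ∈ d.support, v i ^ d i ∈ ∏ i ∈ d.support, I ^ d i :=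
    Ideal.prod_mem_prod fun i _ => Ideal.pow_mem_pow (hv i) _
  rw [Finset.prod_pow_eq_pow_sum] at hprod
  exact Ideal.pow_le_pow_right (hG d hd) hprod

/-- A polynomial evaluated at elements of `I` lies in `I ^ ord₀` (exponent `0` for the zero polynomial).
[cite: Hauser2010, §C (order at a point)] -/
theorem eval₂_mem_pow_ordZero {S : Type v} [CommRing S] {τ : Type*} (f : S →+* R) (I : Ideal R)
    {v : τ → R} (hv : ∀ l, v l ∈ I) (G : MvPolynomial τ S) :
    eval₂ f v G ∈ I ^ (ordZero G).toNat := by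
  by_cases hG0 : G = 0
  · subst hG0; rw [eval₂_zero]; exact Ideal.zero_mem _
  have hle : ((ordZero G).toNat : ℕ∞) ≤ ordZero G := (ENat.coe_toNat (ordZero_ne_top hG0)).le
  exact eval₂_mem_pow_of_forall_le_degree f I hv G fun d hd => (natCast_le_ordZero_iff G _).mp hle d hd

/-- The three entries of `![x, y, z]` lie in the ideal they generate. [folklore] -/
theorem vec3_mem_span (x y z : R) (l : Fin 3) : (![x, y, z] : Fin 3 → R) l ∈ Ideal.span ({x, y, z} : Set R) := by
  refine Ideal.subset_span ?_
  fin_cases l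
  · exact Set.mem_insert _ _
  · exact Set.mem_insert_of_mem _ (Set.mem_insert _ _)
  · exact Set.mem_insert_of_mem _ (Set.mem_insert_of_mem _ (Set.mem_singleton _))

/-! ## §2 Quasi-regularity read on polynomials with coefficients in a field -/

section Field

variable [IsLocalRing R] {K : Type v} [Field K]

/-- **Quasi-regularity for `K`-polynomials in a regular system of parameters.** `R` regular local of embedding dimension `3`,
`(x, y, z)` generating `𝔪`, `κ : K → R` a ring map from a field: if `G(x, y, z) ∈ 𝔪^n` then `n ≤ ord₀ G`. (The lowest form of
`G`, of degree `ν = ord₀ G`, has a non-zero coefficient `c ∈ K`; were `ν < n`, that form would evaluate into `𝔪^{ν+1}`, so by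
quasi-regularity its coefficients — among them the unit `κ(c)` — would lie in `𝔪`.) [cite: Matsumura1987, Thm. 16.2 (i)] -/
theorem natCast_le_ordZero_of_eval₂_mem_pow (hR : IsRegularLocalRing R) (h3 : (maximalIdeal R).spanFinrank = 3)
    {x y z : R} (hxyz : Ideal.span {x, y, z} = maximalIdeal R) (κ : K →+* R) {G : MvPolynomial (Fin 3) K} {n : ℕ}
    (h : eval₂ κ ![x, y, z] G ∈ maximalIdeal R ^ n) : (n : ℕ∞) ≤ ordZero G := by
  classical
  by_cases hG0 : G = 0
  · subst hG0; rw [ordZero_zero]; exact le_top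
  by_contra hlt
  rw [not_le] at hlt
  obtain ⟨ν, hν⟩ : ∃ ν : ℕ, ordZero G = ν := ⟨_, (ENat.coe_toNat (ordZero_ne_top hG0)).symm⟩
  rw [hν] at hlt
  have hνn : ν + 1 ≤ n := by exact_mod_cast (ENat.coe_lt_coe.mp hlt)
  obtain ⟨⟨d₀, hd₀, hd₀deg⟩, hlow⟩ := (ordZero_eq_nat_iff G ν).mp hν
  -- the polynomial over `R` and its homogeneous components
  set P : MvPolynomial (Fin 3) R := MvPolynomial.map κ G with hP
  have hv : ∀ l, (![x, y, z] : Fin 3 → R) l ∈ maximalIdeal R := fun l => hxyz ▸ vec3_mem_span x y z l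
  have hevP : eval ![x, y, z] P = eval₂ κ ![x, y, z] G := MvPolynomial.eval_map κ ![x, y, z] G
  have hcoeffP : ∀ d, coeff d P = κ (coeff d G) := fun d => by rw [hP, coeff_map]
  have hd₀P : coeff d₀ P ≠ 0 := by
    rw [hcoeffP]; exact fun h0 => hd₀ (κ.injective (by rw [h0, map_zero]))
  -- each homogeneous component, evaluated, lies in `𝔪 ^ (its degree)`
  have hcompdeg : ∀ m, eval ![x, y, z] (homogeneousComponent m P) ∈ maximalIdeal R ^ m := by
    intro m
    refine eval₂_mem_pow_of_forall_le_degree (RingHom.id R) (maximalIdeal R) hv (homogeneousComponent m P)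
      fun d hd => ?_
    have hc : coeff d (homogeneousComponent m P) ≠ 0 := MvPolynomial.mem_support_iff.mp hd
    rw [coeff_homogeneousComponent] at hc
    by_cases hdm : d.degree = m
    · exact hdm.ge
    · exact absurd (if_neg hdm) hc
  -- the components of degree `≠ ν`, evaluated, lie in `𝔪^(ν+1)`
  have hcomp : ∀ m, m ≠ ν → eval ![x, y, z] (homogeneousComponent m P) ∈ maximalIdeal R ^ (ν + 1) := by
    intro m hm
    rcases lt_or_gt_of_ne hm with hmν | hmν
    · have h0 : homogeneousComponent m P = 0 := by
        refine homogeneousComponent_eq_zero' m P fun d hd => ?_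
        intro hdeg
        have hc : coeff d G = 0 := hlow d (by rw [hdeg]; exact hmν)
        rw [MvPolynomial.mem_support_iff, hcoeffP, hc, map_zero] at hd
        exact hd rfl
      rw [h0, map_zero]; exact Ideal.zero_mem _
    · exact Ideal.pow_le_pow_right (by omega) (hcompdeg m)
  -- `ν` is among the degrees of `P`
  have hνmem : ν ∈ Finset.range (P.totalDegree + 1) := by
    refine Finset.mem_range.mpr (Nat.lt_succ_of_le ?_)
    have h1 := le_totalDegree (MvPolynomial.mem_support_iff.mpr hd₀P)
    change d₀.degree ≤ P.totalDegree at h1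
    rwa [hd₀deg] at h1
  -- hence the component of degree `ν`, evaluated, lies in `𝔪^(ν+1)`
  have hsum := congrArg (eval ![x, y, z]) (sum_homogeneousComponent P)
  rw [map_sum, ← Finset.sum_erase_add _ _ hνmem] at hsum
  have hrest : ∑ m ∈ (Finset.range (P.totalDegree + 1)).erase ν, eval ![x, y, z] (homogeneousComponent m P) ∈
      maximalIdeal R ^ (ν + 1) :=
    Ideal.sum_mem _ fun m hm => hcomp m (Finset.ne_of_mem_erase hm)
  have hν1 : eval ![x, y, z] (homogeneousComponent ν P) ∈ maximalIdeal R ^ (ν + 1) := by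
    have htot : eval ![x, y, z] P ∈ maximalIdeal R ^ (ν + 1) := by
      rw [hevP]; exact Ideal.pow_le_pow_right hνn h
    have := Ideal.sub_mem _ htot hrest
    rwa [← hsum, add_sub_cancel_left] at this
  -- quasi-regularity: the coefficients of that component lie in `𝔪`, but one of them is a unit
  have hmem := MohWindowSurfaceResidualOrder.coeff_mem_of_eval_mem_pow_succ hR h3 hxyz
    (homogeneousComponent_isHomogeneous ν P) hν1 d₀
  rw [coeff_homogeneousComponent, if_pos hd₀deg, hcoeffP] at hmem
  exact (maximalIdeal.isMaximal R).ne_top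
    (Ideal.eq_top_of_isUnit_mem _ hmem ((isUnit_iff_ne_zero.mpr hd₀).map κ))

/-- **Singularity reading.** If the window ideal `(z^p + G(x,y,z))` lies in `𝔪^p` (the point is a `p`-fold point, `ord ≥ p`),
then `p ≤ ord₀ G`. [cite: Matsumura1987, Thm. 16.2 (i)] -/
theorem natCast_le_ordZero_of_span_le_pow (hR : IsRegularLocalRing R) (h3 : (maximalIdeal R).spanFinrank = 3)
    {x y z : R} (hxyz : Ideal.span {x, y, z} = maximalIdeal R) (κ : K →+* R) {G : MvPolynomial (Fin 3) K} {p : ℕ}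
    (h : Ideal.span {z ^ p + eval₂ κ ![x, y, z] G} ≤ maximalIdeal R ^ p) : (p : ℕ∞) ≤ ordZero G := by
  refine natCast_le_ordZero_of_eval₂_mem_pow hR h3 hxyz κ ?_
  have hz : z ∈ maximalIdeal R := hxyz ▸ vec3_mem_span x y z 2
  have hgen := h (Ideal.mem_span_singleton_self _)
  have := Ideal.sub_mem _ hgen (Ideal.pow_mem_pow hz p)
  rwa [add_sub_cancel_left] at this

omit [IsLocalRing R] in
/-- The converse: if `p ≤ ord₀ G` then `(z^p + G(x,y,z)) ⊆ 𝔪^p` for any ideal `𝔪` containing `x, y, z`. [folklore] -/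
theorem span_le_pow_of_natCast_le_ordZero {I : Ideal R} {x y z : R} (hx : x ∈ I) (hy : y ∈ I) (hz : z ∈ I) (κ : K →+* R)
    {G : MvPolynomial (Fin 3) K} {p : ℕ} (h : (p : ℕ∞) ≤ ordZero G) :
    Ideal.span {z ^ p + eval₂ κ ![x, y, z] G} ≤ I ^ p := by
  rw [Ideal.span_singleton_le_iff_mem]
  refine Ideal.add_mem _ (Ideal.pow_mem_pow hz p) ?_
  have hv : ∀ l, (![x, y, z] : Fin 3 → R) l ∈ I := by
    intro l; fin_cases l <;> assumption
  refine eval₂_mem_pow_of_forall_le_degree κ I hv G fun d hd => ?_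
  exact_mod_cast (natCast_le_ordZero_iff G p).mp h d hd

/-- **The order of the anchor polynomial bounds o1's intrinsic residual order from below**: `ord₀ G ≤ residualOrder p R
(z^p + G(x,y,z))` (witness `w := z`, `n := ord₀ G` in `le_residualOrder`). [folklore] -/
theorem natCast_ordZero_le_residualOrder {x y z : R} (hx : x ∈ maximalIdeal R) (hy : y ∈ maximalIdeal R)
    (hz : z ∈ maximalIdeal R) (κ : K →+* R) (G : MvPolynomial (Fin 3) K) (p : ℕ) :
    ((ordZero G).toNat : ℕ∞) ≤ residualOrder p R (Ideal.span {z ^ p + eval₂ κ ![x, y, z] G}) := by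
  refine le_residualOrder hz ?_
  rw [Ideal.span_singleton_le_iff_mem]
  have hv : ∀ l, (![x, y, z] : Fin 3 → R) l ∈ maximalIdeal R := by
    intro l; fin_cases l <;> assumption
  exact Ideal.add_mem _ (Ideal.mem_sup_left (Ideal.mem_span_singleton_self _))
    (Ideal.mem_sup_right (eval₂_mem_pow_ordZero κ _ hv G))

/-- **Window reading.** If the anchor ideal `(z^p + G(x,y,z))` is a surface window germ of exponent `p` in o1's sense
(`MohWindowSurfaceAt p R ·`: SOME regular system of parameters `(x', y', z')`, some `d` with `p < d < 2p`, some `f ∈ (x',y')^d ∖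
𝔪^{d+1}` present it as `(z'^p + f)`), then `ord₀ G < 2p`: the residual order of the ideal is `d` (res-D-pv-050's
`residualOrder_coeff` on the coefficient presentation `MohWindowSurfaceAt.coeffAt`) and `ord₀ G ≤` it. NOT a statement of the
manuscript. [folklore] -/
theorem ordZero_lt_two_mul_of_mohWindowSurfaceAt {p : ℕ} [Fact p.Prime] [CharP R p] {x y z : R}
    (hx : x ∈ maximalIdeal R) (hy : y ∈ maximalIdeal R) (hz : z ∈ maximalIdeal R) (κ : K →+* R)
    {G : MvPolynomial (Fin 3) K} (hG0 : G ≠ 0)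
    (hwin : MohWindowSurfaceAt p R (Ideal.span {z ^ p + eval₂ κ ![x, y, z] G})) :
    ordZero G < (2 * p : ℕ) := by
  obtain ⟨hR, h3, x', y', z', hxyz', d, a, hpd, hd2, hunit, hI⟩ := hwin.coeffAt
  have hres := MohWindowSurface.residualOrder_coeff p hR h3 hxyz' hpd hd2 hunit (z := z')
  rw [← hI] at hres
  have hle := natCast_ordZero_le_residualOrder hx hy hz κ G p
  rw [hres] at hle
  rw [← ENat.coe_toNat (ordZero_ne_top hG0)]
  exact_mod_cast lt_of_le_of_lt (by exact_mod_cast hle) hd2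

omit [IsLocalRing R] in
/-- For a renaming `ι : τ → Fin 3` with image inside `{0, 1}` (the polynomial lives in the letters `x, y`), the evaluated
polynomial lies in `(x, y)^{ord₀}`. [folklore] -/
theorem eval₂_rename_mem_span_pair_pow {τ : Type*} (ι : τ → Fin 3) (hι : ∀ l, ι l ≠ 2) (x y z : R) (κ : K →+* R)
    (F : MvPolynomial τ K) :
    eval₂ κ ![x, y, z] (rename ι F) ∈ Ideal.span {x, y} ^ (ordZero F).toNat := by
  rw [eval₂_rename]
  refine eval₂_mem_pow_ordZero κ _ (fun l => ?_) F
  have h := hι l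
  show (![x, y, z] : Fin 3 → R) (ι l) ∈ _
  generalize ι l = k at h ⊢
  fin_cases k
  · exact Ideal.subset_span (Set.mem_insert _ _)
  · exact Ideal.subset_span (Set.mem_insert_of_mem _ (Set.mem_singleton _))
  · exact absurd rfl h

/-- **The polynomial sub-regime lies inside o1's regime.** An anchor whose polynomial lives in the two letters `x, y`
(`G = rename ι F`, `ι` injective into `{0, 1}`) with `p < ord₀ F < 2p` presents `(z^p + F(x, y))` as a surface window germ of
exponent `p`, `MohWindowSurfaceAt p R ·` (`d := ord₀ F`, `f := F(x, y) ∈ (x, y)^d`, and `f ∉ 𝔪^{d+1}` by quasi-regularity). NOT a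
statement of the manuscript. [cite: Matsumura1987, Thm. 16.2 (i)] -/
theorem mohWindowSurfaceAt_of_anchor (hR : IsRegularLocalRing R) (h3 : (maximalIdeal R).spanFinrank = 3)
    {x y z : R} (hxyz : Ideal.span {x, y, z} = maximalIdeal R) (κ : K →+* R) {τ : Type*} [DecidableEq τ]
    (ι : τ → Fin 3) (hinj : Function.Injective ι) (hι : ∀ l, ι l ≠ 2) {F : MvPolynomial τ K} {p : ℕ}
    (hpF : (p : ℕ∞) < ordZero F) (hF2 : ordZero F < (2 * p : ℕ)) :
    MohWindowSurfaceAt p R (Ideal.span {z ^ p + eval₂ κ ![x, y, z] (rename ι F)}) := by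
  classical
  have hF0 : F ≠ 0 := by
    rintro rfl; rw [ordZero_zero] at hF2; exact absurd hF2 (not_lt.mpr le_top)
  obtain ⟨d, hd⟩ : ∃ d : ℕ, ordZero F = d := ⟨_, (ENat.coe_toNat (ordZero_ne_top hF0)).symm⟩
  refine ⟨hR, h3, x, y, z, hxyz, d, eval₂ κ ![x, y, z] (rename ι F), ?_, ?_, ?_, ?_, rfl⟩
  · rw [hd] at hpF; exact_mod_cast hpF
  · rw [hd] at hF2; exact_mod_cast hF2
  · have := eval₂_rename_mem_span_pair_pow ι hι x y z κ F
    rwa [hd, ENat.toNat_coe] at this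
  · intro hmem
    have hle := natCast_le_ordZero_of_eval₂_mem_pow hR h3 hxyz κ hmem
    rw [ordZero_rename hinj, hd] at hle
    exact absurd (by exact_mod_cast hle : d + 1 ≤ d) (by omega)

/-! ## §3 Two letters: the model's frame `(j, i)` read as `y_j ↦ x`, `y_i ↦ y`

The residual polynomial of the shade model lives in `K[y_l : l ∈ σ]` with `σ = {j, i}` (`…MohWindowShadeTerminationStatement`:
`i ≠ j`, `∀ l, l = j ∨ l = i`). It is read in `R` through `y_j ↦ x`, `y_i ↦ y`, i.e. through the renaming `j ↦ 0`, `l ↦ 1`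
(`l ≠ j`) into `Fin 3` followed by `![x, y, z]`. -/

variable {σ : Type*} [DecidableEq σ] {j i : σ}

omit [IsLocalRing R] in
/-- The frame renaming `j ↦ 0`, `i ↦ 1` is injective on `σ = {j, i}`. [folklore] -/
theorem frame_rename_injective (hij : i ≠ j) (htwo : ∀ l, l = j ∨ l = i) :
    Function.Injective (fun l : σ => if l = j then (0 : Fin 3) else 1) := by
  intro l l' h
  simp only at h
  rcases htwo l with rfl | rfl <;> rcases htwo l' with rfl | rfl
  · rfl
  · rw [if_pos rfl, if_neg hij] at h; exact absurd h (by decide)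
  · rw [if_neg hij, if_pos rfl] at h; exact absurd h (by decide)
  · rfl

omit [IsLocalRing R] in
/-- The frame renaming avoids the third variable (the polynomial is free of `z`). [folklore] -/
theorem frame_rename_ne_two (l : σ) : (fun l : σ => if l = j then (0 : Fin 3) else 1) l ≠ 2 := by
  simp only
  split_ifs <;> decide

omit [IsLocalRing R] in
/-- Reading `F(y_j ↦ x, y_i ↦ y)` through the frame renaming. [folklore] -/
theorem eval₂_rename_frame (κ : K →+* R) (x y z : R) (F : MvPolynomial σ K) :
    eval₂ κ ![x, y, z] (rename (fun l : σ => if l = j then (0 : Fin 3) else 1) F) =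
      eval₂ κ (fun l => if l = j then x else y) F := by
  rw [eval₂_rename]
  congr 1
  funext l
  simp only [Function.comp_apply]
  split_ifs <;> rfl

/-- **Singularity reading, two letters**: `(z^p + F(x, y)) ⊆ 𝔪^p ⟹ p ≤ ord₀ F`. [cite: Matsumura1987, Thm. 16.2 (i)] -/
theorem natCast_le_ordZero_of_span_le_pow₂ (hR : IsRegularLocalRing R) (h3 : (maximalIdeal R).spanFinrank = 3)
    {x y z : R} (hxyz : Ideal.span {x, y, z} = maximalIdeal R) (κ : K →+* R) (hij : i ≠ j) (htwo : ∀ l, l = j ∨ l = i)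
    {F : MvPolynomial σ K} {p : ℕ}
    (h : Ideal.span {z ^ p + eval₂ κ (fun l => if l = j then x else y) F} ≤ maximalIdeal R ^ p) :
    (p : ℕ∞) ≤ ordZero F := by
  rw [← ordZero_rename (frame_rename_injective hij htwo)]
  refine natCast_le_ordZero_of_span_le_pow hR h3 hxyz κ ?_
  rwa [eval₂_rename_frame]

omit [IsLocalRing R] in
/-- The converse, two letters: `p ≤ ord₀ F ⟹ (z^p + F(x, y)) ⊆ I^p` for any ideal `I ∋ x, y, z`. [folklore] -/
theorem span_le_pow_of_natCast_le_ordZero₂ {I : Ideal R} {x y z : R} (hx : x ∈ I) (hy : y ∈ I) (hz : z ∈ I)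
    (κ : K →+* R) {F : MvPolynomial σ K} {p : ℕ} (h : (p : ℕ∞) ≤ ordZero F) :
    Ideal.span {z ^ p + eval₂ κ (fun l => if l = j then x else y) F} ≤ I ^ p := by
  rw [Ideal.span_singleton_le_iff_mem]
  refine Ideal.add_mem _ (Ideal.pow_mem_pow hz p) (eval₂_mem_pow_of_forall_le_degree κ I (fun l => ?_) F fun d hd => ?_)
  · show (if l = j then x else y) ∈ I
    split_ifs
    · exact hx
    · exact hy
  · exact_mod_cast (natCast_le_ordZero_iff F p).mp h d hd

/-- **Window reading, two letters**: if `(z^p + F(x, y))` is a surface window germ of exponent `p` (`MohWindowSurfaceAt p R ·`, any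
presentation) then `ord₀ F < 2p`. NOT a statement of the manuscript. [folklore] -/
theorem ordZero_lt_two_mul_of_mohWindowSurfaceAt₂ {p : ℕ} [Fact p.Prime] [CharP R p] {x y z : R}
    (hx : x ∈ maximalIdeal R) (hy : y ∈ maximalIdeal R) (hz : z ∈ maximalIdeal R) (κ : K →+* R)
    (hij : i ≠ j) (htwo : ∀ l, l = j ∨ l = i) {F : MvPolynomial σ K} (hF0 : F ≠ 0)
    (hwin : MohWindowSurfaceAt p R (Ideal.span {z ^ p + eval₂ κ (fun l => if l = j then x else y) F})) :
    ordZero F < (2 * p : ℕ) := by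
  rw [← ordZero_rename (frame_rename_injective hij htwo)]
  rw [← eval₂_rename_frame] at hwin
  refine ordZero_lt_two_mul_of_mohWindowSurfaceAt hx hy hz κ ?_ hwin
  exact fun h0 => hF0 (rename_injective _ (frame_rename_injective hij htwo) (by rw [h0, map_zero]))

/-- **The polynomial sub-regime lies inside o1's regime, two letters**: `p < ord₀ F < 2p ⟹ (z^p + F(x, y))` is a surface window
germ of exponent `p`. NOT a statement of the manuscript. [cite: Matsumura1987, Thm. 16.2 (i)] -/
theorem mohWindowSurfaceAt_of_anchor₂ (hR : IsRegularLocalRing R) (h3 : (maximalIdeal R).spanFinrank = 3)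
    {x y z : R} (hxyz : Ideal.span {x, y, z} = maximalIdeal R) (κ : K →+* R) (hij : i ≠ j) (htwo : ∀ l, l = j ∨ l = i)
    {F : MvPolynomial σ K} {p : ℕ} (hpF : (p : ℕ∞) < ordZero F) (hF2 : ordZero F < (2 * p : ℕ)) :
    MohWindowSurfaceAt p R (Ideal.span {z ^ p + eval₂ κ (fun l => if l = j then x else y) F}) := by
  rw [← eval₂_rename_frame]
  exact mohWindowSurfaceAt_of_anchor hR h3 hxyz κ _ (frame_rename_injective hij htwo) frame_rename_ne_two hpF hF2

end Field

end MohWindowShadeAnchor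

end CampaignW46

end Summit.ResolutionOfSingularities.ResolutionOfSingularities.Theorems

end
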